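import Mathlib
import Summits.ResolutionOfSingularities.ResolutionOfSingularities.Theorems.WildQuotientsWildQuotientResolutionJordanFiveRootChart0
import Summits.ResolutionOfSingularities.ResolutionOfSingularities.Theorems.WildQuotientsWildQuotientResolutionJordanFourChart0Subring

/-!
# R-T rung, `J₅`, `μ₄`-vertex: the invariants of the chart subring are the slot image of the weight-`0` part

(crux stmt-ResolutionOfSingularities-15640 `WildQuotients.WildQuotientResolution`, line `Sketch`,
sector `|G| = p`; RUNG V5 of `L/w45c/CHAIN.md` v8 §5/(III), brick B2 (μ₄-vertex plain root chart
`SliceX0`, res-L1-w45c-plan-1 2026-08-27T10:09:28Z) part 2; design of record res-L1-w45c-idea-2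
`RT-J5.md` §3 («μ₄-characters (ρ, N, y₂′, y₃′, y₄′) = (1, p̄, 2, 3, 0) ⇒ Y₀ = ¼(1, p̄, 2, 3) × 𝔸¹»);
the `J₅` twin of `JordanFour.chart0_fixedPoints_eq_map` (B0-b core, res-L1-w45c-stub-1).
[OURS · L1 W4.5c] — NOT a statement of any manuscript; replaces the role of no printed item.
Prover res-type-036. Def-free.)

Root chart `U₀ = k[ρ, y₁, y₂, y₃, y₄, passengers]` of the `μ₄`-vertex chart of the
`(4,3,2,1)`-weighted blow-up for `J₅` (slots `ρ = X a`, `y₁ = X b`, `y₂ = X c`, `y₃ = X d`,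
`y₄ = X e`; `x_a = ρ⁴`, `x_b = ρ³y₁`, `x_c = ρ²y₂`, `x_d = ρy₃`, `x_e = y₄`), so the chart ring is
the weight-`0` part of the `μ₄`-WEIGHT `w₂ : (a, b, c, d) ↦ (1, 1, 2, 3)`, `0` elsewhere
(`ZMod 4`-valued). The lifted action `σ_U` (ABSTRACT by its law `y₁ ↦ y₁ + ρ`, `y₂ ↦ y₂ + ρy₁`,
`y₃ ↦ y₃ + ρy₂`, `y₄ ↦ y₄ + ρy₃`) has fixed ring `k[N, γ₂″, γ₃″, γ₄″, ρ, passengers]`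
(`ToricExit.rootChart5_fixedPoints_eq`, p523699), whose generators are `w₂`-homogeneous of
weights `(p̄, 2, 3, 0)`, `p̄ = p mod 4`.

* `chart0_fixedPoints_eq_map` (core, abstract `R`): for the slot substitution
  `θ : X b ↦ N, X c ↦ γ₂″, X d ↦ γ₃″, X e ↦ γ₄″, X i ↦ X i` and ANY subalgebra `R` which is the
  weight-`0` part of a weight `w₁` with `w₁ (a, b, c, d) = (1, p̄, 2, 3)`, `0` elsewhere:
  `{f | IsWeightedHomogeneous w₂ f 0 ∧ σ_U f = f} = θ(R)` (`p ≥ 5`).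
  Route (V3U-C2 / B0-b): a fixed `f` is `θ P` (part 1); `θ` carries `w₁`-degrees to
  `w₂`-degrees (`JordanFour.weightedHomogeneousComponent_aeval`), so a weight-`0` `f` is `θ` of
  the weight-`0` component of `P`.
Downstream (not here): `R := (presentation of the cone ¼(1, p̄, 2, 3)).range` by one
`mem_range_presentation_iff`-type line (for `p̄ = 3` the weight `(1,3,2,3) = 3·(3,1,2,1)` is the
same cone with the roles of `ρ` and `N` exchanged, `JordanFour.isWeightedHomogeneous_zero_iff_of_mul`).
No algebraic independence of `ρ, N, γ₂″, γ₃″, γ₄″` is claimed or used.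
-/

-- single-problem summit: the doubled namespace component `ResolutionOfSingularities` is forced
set_option linter.dupNamespace false

noncomputable section

open MvPolynomial

namespace Summit.ResolutionOfSingularities.ResolutionOfSingularities.Theorems.WildQuotientResolution.JordanFive

variable (k : Type) [Field k] (n : ℕ)
  (σU : MvPolynomial (Fin n) k ≃ₐ[k] MvPolynomial (Fin n) k) (a b c d e : Fin n)
  (hab : a ≠ b) (hac : a ≠ c) (had : a ≠ d) (hae : a ≠ e) (hbc : b ≠ c) (hbd : b ≠ d)
  (hbe : b ≠ e) (hcd : c ≠ d) (hce : c ≠ e) (hde : d ≠ e)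
  (hb : σU (X b) = X b + X a) (hc : σU (X c) = X c + X a * X b)
  (hd : σU (X d) = X d + X a * X c) (he : σU (X e) = X e + X a * X d)
  (hσ : ∀ i, i ≠ b → i ≠ c → i ≠ d → i ≠ e → σU (X i) = X i)

include hab hac had hae hbc hbd hbe hcd hce hde hb hc hd he hσ in
/-- **B2 core (`J₅`, `μ₄`-vertex).** `{f | f has μ₄-weight 0 ∧ σ_U f = f} = θ(R)` for the slot
substitution `θ` (`X b ↦ N`, `X c ↦ γ₂″`, `X d ↦ γ₃″`, `X e ↦ γ₄″`, rest fixed) and any subalgebra `R`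
equal to the weight-`0` part of a `ZMod 4`-valued weight `w₁` with `w₁ a = 1`, `w₁ b = p`, `w₁ c = 2`,
`w₁ d = 3`, `w₁ = 0` elsewhere; `w₂` is the `μ₄`-weight `(a,b,c,d) ↦ (1,1,2,3)`, `0` elsewhere;
`p ≥ 5`. [OURS · L1 W4.5c] -/
theorem chart0_fixedPoints_eq_map (p : ℕ) (hp : p.Prime) (hp5 : 5 ≤ p) [CharP k p]
    (w₂ : Fin n → ZMod 4) (hw₂a : w₂ a = 1) (hw₂b : w₂ b = 1) (hw₂c : w₂ c = 2) (hw₂d : w₂ d = 3)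
    (hw₂0 : ∀ i, i ≠ a → i ≠ b → i ≠ c → i ≠ d → w₂ i = 0)
    (w₁ : Fin n → ZMod 4) (hw₁a : w₁ a = 1) (hw₁b : w₁ b = (p : ZMod 4)) (hw₁c : w₁ c = 2)
    (hw₁d : w₁ d = 3) (hw₁0 : ∀ i, i ≠ a → i ≠ b → i ≠ c → i ≠ d → w₁ i = 0)
    (R : Subalgebra k (MvPolynomial (Fin n) k)) (hR : ∀ P, P ∈ R ↔ IsWeightedHomogeneous w₁ P 0) :
    {f : MvPolynomial (Fin n) k | IsWeightedHomogeneous w₂ f 0 ∧ σU f = f} =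
      (R.map (aeval (fun i : Fin n => if i = b then X b ^ p - X a ^ (p - 1) * X b
          else if i = c then 2 * X c - X b ^ 2 + X a * X b
          else if i = d then 3 * X d - 3 * (X b * X c) + X b ^ 3 - X a * X b ^ 2 + 2 * (X a * X c)
          else if i = e then 4 * X e - 4 * (X b * X d) - 2 * X c ^ 2 + 4 * (X b ^ 2 * X c) - X b ^ 4
            + X a * X b ^ 3 - 3 * (X a * X b * X c) + 3 * (X a * X d)
          else (X i : MvPolynomial (Fin n) k)) :
          MvPolynomial (Fin n) k →ₐ[k] MvPolynomial (Fin n) k) : Set (MvPolynomial (Fin n) k)) := by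
  classical
  haveI : Fact p.Prime := ⟨hp⟩
  have hp1 : p - 1 + 1 = p := Nat.sub_add_cancel hp.one_lt.le
  have ha : σU (X a) = X a := hσ a hab hac had hae
  -- the invariants and the slot substitution `θ = aeval g`
  set N : MvPolynomial (Fin n) k := X b ^ p - X a ^ (p - 1) * X b with hN
  set γ2 : MvPolynomial (Fin n) k := 2 * X c - X b ^ 2 + X a * X b with hγ2
  set γ3 : MvPolynomial (Fin n) k :=
    3 * X d - 3 * (X b * X c) + X b ^ 3 - X a * X b ^ 2 + 2 * (X a * X c) with hγ3
  set γ4 : MvPolynomial (Fin n) k :=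
    4 * X e - 4 * (X b * X d) - 2 * X c ^ 2 + 4 * (X b ^ 2 * X c) - X b ^ 4
      + X a * X b ^ 3 - 3 * (X a * X b * X c) + 3 * (X a * X d) with hγ4
  let g : Fin n → MvPolynomial (Fin n) k := fun i =>
    if i = b then N else if i = c then γ2 else if i = d then γ3 else if i = e then γ4 else X i
  have hgb : g b = N := if_pos rfl
  have hgc : g c = γ2 := by
    change (if c = b then N else if c = c then γ2 else if c = d then γ3 else if c = e then γ4
      else X c) = γ2
    rw [if_neg (Ne.symm hbc), if_pos rfl]
  have hgd : g d = γ3 := by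
    change (if d = b then N else if d = c then γ2 else if d = d then γ3 else if d = e then γ4
      else X d) = γ3
    rw [if_neg (Ne.symm hbd), if_neg (Ne.symm hcd), if_pos rfl]
  have hge : g e = γ4 := by
    change (if e = b then N else if e = c then γ2 else if e = d then γ3 else if e = e then γ4
      else X e) = γ4
    rw [if_neg (Ne.symm hbe), if_neg (Ne.symm hce), if_neg (Ne.symm hde), if_pos rfl]
  have hgi : ∀ i, i ≠ b → i ≠ c → i ≠ d → i ≠ e → g i = X i := by
    intro i hib hic hid hie
    change (if i = b then N else if i = c then γ2 else if i = d then γ3 else if i = e then γ4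
      else X i) = X i
    rw [if_neg hib, if_neg hic, if_neg hid, if_neg hie]
  have hga : g a = X a := hgi a hab hac had hae
  -- `σ_U` fixes the images of `g`
  have hσN : σU N = N :=
    ToricExit.rootChart4_artinSchreier (σU : MvPolynomial (Fin n) k →+* MvPolynomial (Fin n) k)
      a b ha hb p
  have hσ2 : σU γ2 = γ2 :=
    ToricExit.rootChart4_gamma_invariant (σU : MvPolynomial (Fin n) k →+* MvPolynomial (Fin n) k)
      a b c ha hb hc
  have hσ3 : σU γ3 = γ3 :=
    ToricExit.rootChart5_gamma3_invariant
      (σU : MvPolynomial (Fin n) k →+* MvPolynomial (Fin n) k) a b c d ha hb hc hd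
  have hσ4 : σU γ4 = γ4 :=
    ToricExit.rootChart5_gamma4_invariant
      (σU : MvPolynomial (Fin n) k →+* MvPolynomial (Fin n) k) a b c d e ha hb hc hd he
  have hσg : ∀ i, σU (g i) = g i := by
    intro i
    by_cases hib : i = b
    · subst hib; rw [hgb, hσN]
    by_cases hic : i = c
    · subst hic; rw [hgc, hσ2]
    by_cases hid : i = d
    · subst hid; rw [hgd, hσ3]
    by_cases hie : i = e
    · subst hie; rw [hge, hσ4]
    · rw [hgi i hib hic hid hie, hσ i hib hic hid hie]
  have hσθ : ∀ P : MvPolynomial (Fin n) k,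
      σU ((aeval g : MvPolynomial (Fin n) k →ₐ[k] MvPolynomial (Fin n) k) P) =
        (aeval g : MvPolynomial (Fin n) k →ₐ[k] MvPolynomial (Fin n) k) P := by
    intro P
    have key : (σU : MvPolynomial (Fin n) k →ₐ[k] MvPolynomial (Fin n) k).comp (aeval g) =
        aeval g := by
      refine MvPolynomial.algHom_ext fun i => ?_
      change σU (aeval g (X i)) = aeval g (X i)
      rw [aeval_X, hσg]
    exact congrArg (fun φ : MvPolynomial (Fin n) k →ₐ[k] MvPolynomial (Fin n) k => φ P) key
  -- weight bookkeeping: every `g i` is `w₂`-homogeneous of degree `w₁ i`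
  have fixφ : ∀ {φ φ' : MvPolynomial (Fin n) k} {m m' : ZMod 4},
      IsWeightedHomogeneous w₂ φ m → φ = φ' → m = m' → IsWeightedHomogeneous w₂ φ' m' := by
    rintro φ φ' m m' h rfl rfl
    exact h
  have hsub : ∀ {φ ψ : MvPolynomial (Fin n) k} {m : ZMod 4}, IsWeightedHomogeneous w₂ φ m →
      IsWeightedHomogeneous w₂ ψ m → IsWeightedHomogeneous w₂ (φ - ψ) m :=
    fun h1 h2 => (weightedHomogeneousSubmodule k w₂ _).sub_mem h1 h2
  have hX : ∀ i (m : ZMod 4), w₂ i = m →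
      IsWeightedHomogeneous w₂ (X i : MvPolynomial (Fin n) k) m := by
    intro i m him
    have h := isWeightedHomogeneous_X k w₂ i
    rwa [him] at h
  have hXa := hX a 1 hw₂a
  have hXb := hX b 1 hw₂b
  have hXc := hX c 2 hw₂c
  have hXd := hX d 3 hw₂d
  have hXe := hX e 0 (hw₂0 e (Ne.symm hae) (Ne.symm hbe) (Ne.symm hce) (Ne.symm hde))
  have hNw : IsWeightedHomogeneous w₂ N (p : ZMod 4) := by
    have h1 : IsWeightedHomogeneous w₂ (X b ^ p : MvPolynomial (Fin n) k) (p : ZMod 4) := by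
      have h := hXb.pow p
      rwa [nsmul_eq_mul, mul_one] at h
    have h2 : IsWeightedHomogeneous w₂ (X a ^ (p - 1) * X b : MvPolynomial (Fin n) k)
        (p : ZMod 4) := by
      have h := (hXa.pow (p - 1)).mul hXb
      rwa [nsmul_eq_mul, mul_one, ← Nat.cast_add_one, hp1] at h
    exact hsub h1 h2
  have hγ2w : IsWeightedHomogeneous w₂ γ2 2 := by
    have t1 : IsWeightedHomogeneous w₂ (2 * X c : MvPolynomial (Fin n) k) 2 :=
      fixφ (hXc.C_mul (2 : k)) (by rw [map_ofNat]) rfl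
    have t2 : IsWeightedHomogeneous w₂ (X b ^ 2 : MvPolynomial (Fin n) k) 2 :=
      fixφ (hXb.pow 2) rfl (by decide)
    have t3 : IsWeightedHomogeneous w₂ (X a * X b : MvPolynomial (Fin n) k) 2 :=
      fixφ (hXa.mul hXb) rfl (by decide)
    exact (hsub t1 t2).add t3
  have hγ3w : IsWeightedHomogeneous w₂ γ3 3 := by
    have t1 : IsWeightedHomogeneous w₂ (3 * X d : MvPolynomial (Fin n) k) 3 :=
      fixφ (hXd.C_mul (3 : k)) (by rw [map_ofNat]) rfl
    have t2 : IsWeightedHomogeneous w₂ (3 * (X b * X c) : MvPolynomial (Fin n) k) 3 :=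
      fixφ ((hXb.mul hXc).C_mul (3 : k)) (by rw [map_ofNat]) (by decide)
    have t3 : IsWeightedHomogeneous w₂ (X b ^ 3 : MvPolynomial (Fin n) k) 3 :=
      fixφ (hXb.pow 3) rfl (by decide)
    have t4 : IsWeightedHomogeneous w₂ (X a * X b ^ 2 : MvPolynomial (Fin n) k) 3 :=
      fixφ (hXa.mul (hXb.pow 2)) rfl (by decide)
    have t5 : IsWeightedHomogeneous w₂ (2 * (X a * X c) : MvPolynomial (Fin n) k) 3 :=
      fixφ ((hXa.mul hXc).C_mul (2 : k)) (by rw [map_ofNat]) (by decide)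
    exact (hsub ((hsub t1 t2).add t3) t4).add t5
  have hγ4w : IsWeightedHomogeneous w₂ γ4 0 := by
    have u1 : IsWeightedHomogeneous w₂ (4 * X e : MvPolynomial (Fin n) k) 0 :=
      fixφ (hXe.C_mul (4 : k)) (by rw [map_ofNat]) rfl
    have u2 : IsWeightedHomogeneous w₂ (4 * (X b * X d) : MvPolynomial (Fin n) k) 0 :=
      fixφ ((hXb.mul hXd).C_mul (4 : k)) (by rw [map_ofNat]) (by decide)
    have u3 : IsWeightedHomogeneous w₂ (2 * X c ^ 2 : MvPolynomial (Fin n) k) 0 :=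
      fixφ ((hXc.pow 2).C_mul (2 : k)) (by rw [map_ofNat]) (by decide)
    have u4 : IsWeightedHomogeneous w₂ (4 * (X b ^ 2 * X c) : MvPolynomial (Fin n) k) 0 :=
      fixφ (((hXb.pow 2).mul hXc).C_mul (4 : k)) (by rw [map_ofNat]) (by decide)
    have u5 : IsWeightedHomogeneous w₂ (X b ^ 4 : MvPolynomial (Fin n) k) 0 :=
      fixφ (hXb.pow 4) rfl (by decide)
    have u6 : IsWeightedHomogeneous w₂ (X a * X b ^ 3 : MvPolynomial (Fin n) k) 0 :=
      fixφ (hXa.mul (hXb.pow 3)) rfl (by decide)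
    have u7 : IsWeightedHomogeneous w₂ (3 * (X a * X b * X c) : MvPolynomial (Fin n) k) 0 :=
      fixφ (((hXa.mul hXb).mul hXc).C_mul (3 : k)) (by rw [map_ofNat]) (by decide)
    have u8 : IsWeightedHomogeneous w₂ (3 * (X a * X d) : MvPolynomial (Fin n) k) 0 :=
      fixφ ((hXa.mul hXd).C_mul (3 : k)) (by rw [map_ofNat]) (by decide)
    exact (hsub ((hsub ((hsub (hsub u1 u2) u3).add u4) u5).add u6) u7).add u8
  have hgw : ∀ i, IsWeightedHomogeneous w₂ (g i) (w₁ i) := by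
    intro i
    by_cases hia : i = a
    · subst hia; rw [hga, hw₁a]; exact hXa
    by_cases hib : i = b
    · subst hib; rw [hgb, hw₁b]; exact hNw
    by_cases hic : i = c
    · subst hic; rw [hgc, hw₁c]; exact hγ2w
    by_cases hid : i = d
    · subst hid; rw [hgd, hw₁d]; exact hγ3w
    by_cases hie : i = e
    · subst hie; rw [hge, hw₁0 i hia hib hic hid]; exact hγ4w
    · rw [hgi i hib hic hid hie, hw₁0 i hia hib hic hid]
      exact hX i 0 (hw₂0 i hia hib hic hid)
  -- `k[N, γ₂″, γ₃″, γ₄″, X i (i ∉ {b,c,d,e})] ≤ range (aeval g)`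
  have hFle : Algebra.adjoin k (({N, γ2, γ3, γ4} : Set (MvPolynomial (Fin n) k)) ∪
      ((fun i => X i) '' {i | i ≠ b ∧ i ≠ c ∧ i ≠ d ∧ i ≠ e})) ≤
        (aeval g : MvPolynomial (Fin n) k →ₐ[k] MvPolynomial (Fin n) k).range := by
    refine Algebra.adjoin_le ?_
    rintro x hx
    rcases hx with hx | ⟨i, ⟨hib, hic, hid, hie⟩, rfl⟩
    · simp only [Set.mem_insert_iff, Set.mem_singleton_iff] at hx
      rcases hx with rfl | rfl | rfl | rfl
      · exact (AlgHom.mem_range _).mpr ⟨X b, by rw [aeval_X, hgb]⟩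
      · exact (AlgHom.mem_range _).mpr ⟨X c, by rw [aeval_X, hgc]⟩
      · exact (AlgHom.mem_range _).mpr ⟨X d, by rw [aeval_X, hgd]⟩
      · exact (AlgHom.mem_range _).mpr ⟨X e, by rw [aeval_X, hge]⟩
    · exact (AlgHom.mem_range _).mpr ⟨X i, by rw [aeval_X, hgi i hib hic hid hie]⟩
  apply Set.Subset.antisymm
  · -- `⊆`: a fixed weight-`0` `f` is `θ` of the weight-`0` part of a preimage
    rintro f ⟨hf0, hfσ⟩
    have hfF := ToricExit.mem_adjoin_of_rootChart5_eq k n σU a b c d e hab hac had hae hbc hbd hbe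
      hcd hce hde hb hc hd he hσ p hp hp5 f hfσ
    obtain ⟨P, hP⟩ := (AlgHom.mem_range _).mp (hFle hfF)
    have hcomp : f = aeval g (weightedHomogeneousComponent w₁ 0 P) := by
      rw [← JordanFour.weightedHomogeneousComponent_aeval w₁ w₂ g hgw P 0, hP]
      exact (hf0.weightedHomogeneousComponent_same).symm
    rw [hcomp]
    exact Subalgebra.mem_map.mpr
      ⟨_, (hR _).mpr (weightedHomogeneousComponent_isWeightedHomogeneous 0 P), rfl⟩
  · -- `⊇`: `θ(R)` has weight `0` and is fixed
    rintro f hf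
    obtain ⟨P, hPR, rfl⟩ := Subalgebra.mem_map.mp hf
    exact ⟨ToricExit.isWeightedHomogeneous_aeval w₁ w₂ g hgw P 0 ((hR P).mp hPR), hσθ P⟩

end Summit.ResolutionOfSingularities.ResolutionOfSingularities.Theorems.WildQuotientResolution.JordanFive

end
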